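import Mathlib.Analysis.SpecialFunctions.Log.Summable
import Mathlib.Topology.Algebra.InfiniteSum.Real
import HarnessLib

/-!
# The analytic skeleton of the square-free sieve (Bhargava–Shankar, Thm 2.21): exchanging the
# level limit with the Euler product, and the sandwich

`Proofs` file (theorems only: no definitions, no named facts), pure real analysis. Source:
M. Bhargava, A. Shankar, *Binary quartic forms having bounded invariants, and the boundedness of
the average rank of elliptic curves*, Ann. of Math. (2) 181 (2015) 191–242, §2.7 of the published
version (= `arXiv:1006.1002v3`), proof of Thm 2.21:

> "it follows from Theorem 2.12 that, for any fixed `Y`,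
> `limsup_X N_φ/X^{5/6} ≤ limsup_X N^Y_{ψ'}/X^{5/6} = lim_X N/X^{5/6} · ∏_p ∫ ψ'_{p,⌊Y/p⌋}`. …
> Letting `Y` tend to infinity … `limsup_X N_φ/X^{5/6} ≤ lim_X N/X^{5/6} · ∏_p ∫ φ_p`. We now obtain
> a lower bound using Theorem 2.13 …
> `liminf_X N_φ/X^{5/6} ≥ liminf_X [N^Y_ψ/X^{5/6} − O(N(∪_{p>Y} W_p;X))/X^{5/6}]
>  = lim_X N/X^{5/6} · ∏_p ∫ ψ_{p,⌊Y/p⌋} − O(1/log Y)` …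
> Taking the limit as `Y` tends to infinity then yields [the theorem], where we use (27)
> [`1 − ∫ φ_p ≪ p⁻²`] to exchange the limit (in `Y`) and product, and (26) to exchange the limit
> (in `Y`) and integral."

The counting theorems (Thms 2.1, 2.12, 2.13) and the local data (the envelopes `ψ_{p,n} ↑ φ_p`,
`ψ'_{p,n} ↓ φ_p` of `BinaryQuarticCongruenceEnvelopesProofs`, the density bound
`μ_p(W_p) ≪ p⁻²` of `BinaryQuarticDiscriminantDensityProofs`) enter this argument only through
real numbers and real functions; this file proves the argument in that abstract form, over an
arbitrary index type `ι` (the primes) and level sets `P_Y` with levels `n_Y(i)`: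

* §1 `abs_prod_sub_prod_le_sum`: `|∏ xᵢ − ∏ yᵢ| ≤ ∑ |xᵢ − yᵢ|` on `[0,1]`;
  `prod_le_prod_of_subset_of_mem_Icc`.
* §2 `multipliable_of_summable_one_sub`, `tendsto_prod_tprod`: `aᵢ ∈ [0,1]`, `∑(1 − aᵢ) < ∞`
  (here `aᵢ = ∫ φ_p`, by (27)) give a convergent product approached by the partial products.
* §3 `eventually_prod_le_tprod_add` (**upper bound**): if `bᵢ(n) ∈ [0,1]` tend to `aᵢ`
  (`bᵢ(n) = ∫ ψ'_{p,n}`, by (26)), `P_Y` exhausts `ι` and `n_Y(i) → ∞`, then eventually in `Y`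
  `∏_{i∈P_Y} bᵢ(n_Y(i)) ≤ ∏' aᵢ + ε`.
* §4 `eventually_tprod_sub_le_prod` (**lower bound**, the exchange of limit and product): if
  `a'ᵢ(n) ∈ [0,1]` increase to `aᵢ` (`a'ᵢ(n) = ∫ ψ_{p,n}`) and `a'ᵢ(n) ≥ 1 − cᵢ` for `n ≥ 2` with
  `∑ cᵢ < ∞` (acceptability + (27); `cᵢ = 1` is allowed at finitely many bad indices), levels
  `n_Y(i) ≥ 2`, then eventually in `Y` `∏' aᵢ − ε ≤ ∏_{i∈P_Y} a'ᵢ(n_Y(i))`.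
* §5 `tendsto_of_sandwich_levels` (**the sandwich**): if for every `Y`,
  `f_Y⁻(X) − e_Y(X) ≤ f(X) ≤ f_Y⁺(X)` for large `X` with `f_Y^± → c·U_Y`, `c·L_Y` (Thm 2.12),
  `limsup_X e_Y ≤ u_Y → 0` (Thm 2.13), and `U_Y`, `L_Y` satisfy the conclusions of §3–§4, then
  `f(X) → c·∏' aᵢ` — Thm 2.21 with `f = N_φ(V_ℤ^{(i)};X)/X^{5/6}`.

## References

* M. Bhargava, A. Shankar, Ann. of Math. (2) 181 (2015) 191–242, §2.7, Thm 2.21 and its proof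
  (published numbering). [cite: BhargavaShankarAnnals2015, §2.7, proof of Thm 2.21 (published numbering)]
-/

noncomputable section

open scoped Classical Topology
open Filter Finset

namespace Literature.NumberTheory.EllipticCurves

namespace BhargavaShankar

/-! ## §1. Finite products of numbers in `[0,1]` -/

/-- **`|∏ xᵢ − ∏ yᵢ| ≤ ∑ |xᵢ − yᵢ|` for `xᵢ, yᵢ ∈ [0,1]`.** [folklore] -/
theorem abs_prod_sub_prod_le_sum {ι : Type*} (s : Finset ι) {x y : ι → ℝ}
    (hx : ∀ i ∈ s, 0 ≤ x i ∧ x i ≤ 1) (hy : ∀ i ∈ s, 0 ≤ y i ∧ y i ≤ 1) :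
    |∏ i ∈ s, x i - ∏ i ∈ s, y i| ≤ ∑ i ∈ s, |x i - y i| := by
  classical
  induction s using Finset.induction_on with
  | empty => simp
  | insert a s has ih =>
      have hx' : ∀ i ∈ s, 0 ≤ x i ∧ x i ≤ 1 := fun i hi => hx i (mem_insert_of_mem hi)
      have hy' : ∀ i ∈ s, 0 ≤ y i ∧ y i ≤ 1 := fun i hi => hy i (mem_insert_of_mem hi)
      have hxa := hx a (mem_insert_self a s)
      have hya := hy a (mem_insert_self a s)
      rw [prod_insert has, prod_insert has, sum_insert has]
      have hPy : |∏ i ∈ s, y i| ≤ 1 := by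
        rw [abs_of_nonneg (prod_nonneg fun i hi => (hy' i hi).1)]
        exact prod_le_one (fun i hi => (hy' i hi).1) fun i hi => (hy' i hi).2
      have hxa' : |x a| ≤ 1 := by rw [abs_of_nonneg hxa.1]; exact hxa.2
      calc |x a * ∏ i ∈ s, x i - y a * ∏ i ∈ s, y i|
            = |x a * (∏ i ∈ s, x i - ∏ i ∈ s, y i) + (x a - y a) * ∏ i ∈ s, y i| := by ring_nf
        _ ≤ |x a * (∏ i ∈ s, x i - ∏ i ∈ s, y i)| + |(x a - y a) * ∏ i ∈ s, y i| := abs_add_le _ _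
        _ = |x a| * |∏ i ∈ s, x i - ∏ i ∈ s, y i| + |x a - y a| * |∏ i ∈ s, y i| := by
            rw [abs_mul, abs_mul]
        _ ≤ 1 * (∑ i ∈ s, |x i - y i|) + |x a - y a| * 1 := by
            gcongr
            exact ih hx' hy'
        _ = |x a - y a| + ∑ i ∈ s, |x i - y i| := by ring

/-- A product of numbers in `[0,1]` over a larger finite set is smaller. [folklore] -/
theorem prod_le_prod_of_subset_of_mem_Icc {ι : Type*} {s t : Finset ι} (hst : s ⊆ t) {f : ι → ℝ}
    (hf : ∀ i ∈ t, 0 ≤ f i ∧ f i ≤ 1) : ∏ i ∈ t, f i ≤ ∏ i ∈ s, f i := by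
  classical
  rw [← prod_sdiff hst]
  have h1 : ∏ i ∈ t \ s, f i ≤ 1 :=
    prod_le_one (fun i hi => (hf i (mem_sdiff.mp hi).1).1) fun i hi => (hf i (mem_sdiff.mp hi).1).2
  have h2 : 0 ≤ ∏ i ∈ s, f i := prod_nonneg fun i hi => (hf i (hst hi)).1
  calc (∏ i ∈ t \ s, f i) * ∏ i ∈ s, f i ≤ 1 * ∏ i ∈ s, f i := by gcongr
    _ = ∏ i ∈ s, f i := one_mul _

/-! ## §2. The infinite product `∏ aᵢ` of numbers in `[0,1]` with `∑ (1 − aᵢ) < ∞` -/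

/-- `∏ aᵢ` converges (unconditionally) when `aᵢ ∈ [0,1]` and `∑ (1 − aᵢ) < ∞`. [folklore] -/
theorem multipliable_of_summable_one_sub {ι : Type*} {a : ι → ℝ} (ha0 : ∀ i, 0 ≤ a i)
    (ha1 : ∀ i, a i ≤ 1) (hs : Summable fun i => 1 - a i) : Multipliable a := by
  have h : Multipliable fun i => 1 + (a i - 1) := by
    refine multipliable_one_add_of_summable ?_
    refine hs.congr fun i => ?_
    rw [Real.norm_eq_abs, abs_of_nonpos (by linarith [ha1 i])]
    ring
  have _ := ha0
  exact h.congr fun i => by ring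

/-- The finite partial products converge to `∏' aᵢ` along any exhausting sequence of finite sets.
[folklore] -/
theorem tendsto_prod_tprod {ι : Type*} {a : ι → ℝ} (ha0 : ∀ i, 0 ≤ a i) (ha1 : ∀ i, a i ≤ 1)
    (hs : Summable fun i => 1 - a i) {P : ℕ → Finset ι} (hP : Tendsto P atTop atTop) :
    Tendsto (fun Y => ∏ i ∈ P Y, a i) atTop (𝓝 (∏' i, a i)) :=
  ((multipliable_of_summable_one_sub ha0 ha1 hs).hasProd).comp hP

/-! ## §3. Upper envelopes: `limsup_Y ∏_{i ∈ P_Y} bᵢ(n_Y(i)) ≤ ∏' aᵢ` -/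

/-- **Upper bound of the sieve** (Bhargava–Shankar 2015, proof of Thm 2.21: "Letting `Y` tend to
infinity, we have … `limsup_X N_φ/X^{5/6} ≤ lim_X N/X^{5/6} · ∏_p ∫ φ_p`"), abstract form. Let
`aᵢ ∈ [0,1]` with `∑ (1 − aᵢ) < ∞`, let `bᵢ(n) ∈ [0,1]` converge to `aᵢ` as `n → ∞` for each `i`
(the integrals `∫ ψ'_{p,n}` of the upper envelopes), let `P_Y` be finite sets exhausting the index
set and `n_Y(i) → ∞` levels. Then for every `ε > 0`, eventually in `Y`,
`∏_{i ∈ P_Y} bᵢ(n_Y(i)) ≤ ∏' aᵢ + ε`. [cite: BhargavaShankarAnnals2015, §2.7, proof of Thm 2.21 (published numbering)] -/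
theorem eventually_prod_le_tprod_add {ι : Type*} {a : ι → ℝ} (ha0 : ∀ i, 0 ≤ a i)
    (ha1 : ∀ i, a i ≤ 1) (hs : Summable fun i => 1 - a i) {b : ι → ℕ → ℝ}
    (hb0 : ∀ i n, 0 ≤ b i n) (hb1 : ∀ i n, b i n ≤ 1) (hba : ∀ i, Tendsto (b i) atTop (𝓝 (a i)))
    {P : ℕ → Finset ι} (hP : Tendsto P atTop atTop) {n : ℕ → ι → ℕ}
    (hn : ∀ i, Tendsto (fun Y => n Y i) atTop atTop) {ε : ℝ} (hε : 0 < ε) :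
    ∀ᶠ Y in atTop, ∏ i ∈ P Y, b i (n Y i) ≤ ∏' i, a i + ε := by
  have hprod := (multipliable_of_summable_one_sub ha0 ha1 hs).hasProd
  -- a finite set `Q₀` whose partial product is within `ε/2` of the infinite product
  obtain ⟨Q₀, hQ₀⟩ : ∃ Q₀ : Finset ι, ∏ i ∈ Q₀, a i < ∏' i, a i + ε / 2 := by
    have h := (hprod.eventually (Iio_mem_nhds (by linarith : ∏' i, a i < ∏' i, a i + ε / 2)))
    exact h.exists
  -- the finite product of the `bᵢ(n_Y i)` over `Q₀` converges to that of the `aᵢ`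
  have hfin : Tendsto (fun Y => ∏ i ∈ Q₀, b i (n Y i)) atTop (𝓝 (∏ i ∈ Q₀, a i)) :=
    tendsto_finsetProd Q₀ fun i _ => (hba i).comp (hn i)
  have h1 : ∀ᶠ Y in atTop, ∏ i ∈ Q₀, b i (n Y i) < ∏' i, a i + ε / 2 :=
    hfin.eventually (Iio_mem_nhds hQ₀)
  filter_upwards [h1, hP.eventually_ge_atTop Q₀] with Y hY hQY
  calc ∏ i ∈ P Y, b i (n Y i) ≤ ∏ i ∈ Q₀, b i (n Y i) :=
        prod_le_prod_of_subset_of_mem_Icc hQY fun i _ => ⟨hb0 i _, hb1 i _⟩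
    _ ≤ ∏' i, a i + ε := by linarith

/-! ## §4. Lower envelopes: `liminf_Y ∏_{i ∈ P_Y} a'ᵢ(n_Y(i)) ≥ ∏' aᵢ` -/

/-- A finite sum of a nonnegative summable function over a set disjoint from `Q` is at most the sum
over the complement of `Q`. [folklore] -/
theorem sum_sdiff_le_tsum_subtype {ι : Type*} {c : ι → ℝ} (hc : Summable c) (hc0 : ∀ i, 0 ≤ c i)
    (S Q : Finset ι) : ∑ i ∈ S \ Q, c i ≤ ∑' i : {x // x ∉ Q}, c i := by
  classical
  show ∑ i ∈ S \ Q, c i ≤ ∑' i : ({x | x ∉ Q} : Set ι), c i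
  rw [_root_.tsum_subtype]
  have hind : Summable ({x | x ∉ Q}.indicator c) := hc.indicator _
  calc ∑ i ∈ S \ Q, c i = ∑ i ∈ S \ Q, {x | x ∉ Q}.indicator c i := by
        refine sum_congr rfl fun i hi => ?_
        rw [Set.indicator_of_mem (show i ∈ {x | x ∉ Q} from (mem_sdiff.mp hi).2)]
    _ ≤ ∑' i, {x | x ∉ Q}.indicator c i :=
        hind.sum_le_tsum (S \ Q) fun i _ => Set.indicator_nonneg (fun j _ => hc0 j) i

/-- **Lower bound of the sieve** (Bhargava–Shankar 2015, proof of Thm 2.21: "`liminf_X N_φ/X^{5/6}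
≥ … ∏_p ∫ ψ_{p,⌊Y/p⌋} − O(1/log Y)` … Taking the limit as `Y` tends to infinity then yields …
where we use `1 − ∫φ_p ≪ p⁻²` to exchange the limit (in `Y`) and product"), abstract form. Let
`aᵢ ∈ [0,1]` with `∑ (1 − aᵢ) < ∞`; let `a'ᵢ(n) ∈ [0,1]` increase to `aᵢ` as `n → ∞` (the integrals
`∫ ψ_{p,n}` of the lower envelopes) with the uniform tail bound `a'ᵢ(n) ≥ 1 − cᵢ` for `n ≥ 2`,
`∑ cᵢ < ∞` (acceptability: `ψ_{p,n} = 1` off `W_p` for `n ≥ 2`, `μ_p(W_p) ≪ p⁻²`); let `P_Y` exhaust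
the index set with levels `n_Y(i) ≥ 2` tending to `∞`. Then for every `ε > 0`, eventually in `Y`,
`∏' aᵢ − ε ≤ ∏_{i ∈ P_Y} a'ᵢ(n_Y(i))`. [cite: BhargavaShankarAnnals2015, §2.7, proof of Thm 2.21 (published numbering)] -/
theorem eventually_tprod_sub_le_prod {ι : Type*} {a : ι → ℝ} (ha0 : ∀ i, 0 ≤ a i)
    (ha1 : ∀ i, a i ≤ 1) (hs : Summable fun i => 1 - a i) {a' : ι → ℕ → ℝ}
    (ha'0 : ∀ i n, 0 ≤ a' i n) (hmono : ∀ i, Monotone (a' i))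
    (ha'a : ∀ i, Tendsto (a' i) atTop (𝓝 (a i))) {c : ι → ℝ} (hc : Summable c)
    (hc0 : ∀ i, 0 ≤ c i) (hlow : ∀ i n, 2 ≤ n → 1 - c i ≤ a' i n)
    {P : ℕ → Finset ι} (hP : Tendsto P atTop atTop) {n : ℕ → ι → ℕ}
    (hn : ∀ i, Tendsto (fun Y => n Y i) atTop atTop) (hn2 : ∀ Y, ∀ i ∈ P Y, 2 ≤ n Y i)
    {ε : ℝ} (hε : 0 < ε) :
    ∀ᶠ Y in atTop, ∏' i, a i - ε ≤ ∏ i ∈ P Y, a' i (n Y i) := by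
  have ha'le : ∀ i n, a' i n ≤ a i := fun i n => (hmono i).ge_of_tendsto (ha'a i) n
  -- (1) a finite set `Q` off which `∑ cᵢ < ε/3`
  obtain ⟨Q, hQ⟩ : ∃ Q : Finset ι, ∑' i : {x // x ∉ Q}, c i < ε / 3 := by
    have h := (tendsto_tsum_compl_atTop_zero c).eventually
      (Iio_mem_nhds (by linarith : (0 : ℝ) < ε / 3))
    exact h.exists
  -- (2) the partial products of `a` over `P_Y` approach the infinite product
  have h2 : ∀ᶠ Y in atTop, ∏' i, a i - ε / 3 < ∏ i ∈ P Y, a i :=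
    (tendsto_prod_tprod ha0 ha1 hs hP).eventually (Ioi_mem_nhds (by linarith))
  -- (3) on `Q` the `a'ᵢ(n_Y i)` approach the `aᵢ`
  have h3 : ∀ᶠ Y in atTop, ∑ i ∈ Q, |a i - a' i (n Y i)| < ε / 3 := by
    have hfin : Tendsto (fun Y => ∑ i ∈ Q, |a i - a' i (n Y i)|) atTop (𝓝 (∑ i ∈ Q, (0 : ℝ))) := by
      refine tendsto_finsetSum Q fun i _ => ?_
      have h := (tendsto_const_nhds (x := a i)).sub ((ha'a i).comp (hn i))
      rw [sub_self] at h
      simpa using h.abs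
    rw [sum_const_zero] at hfin
    exact hfin.eventually (Iio_mem_nhds (by linarith))
  filter_upwards [h2, h3, hP.eventually_ge_atTop Q] with Y hY2 hY3 hQY
  -- compare the two products over `P_Y`
  have hdiff : |∏ i ∈ P Y, a i - ∏ i ∈ P Y, a' i (n Y i)| ≤ ε / 3 + ε / 3 := by
    calc _ ≤ ∑ i ∈ P Y, |a i - a' i (n Y i)| :=
          abs_prod_sub_prod_le_sum (P Y) (fun i _ => ⟨ha0 i, ha1 i⟩) (fun i _ => ⟨ha'0 i _, (ha'le i _).trans (ha1 i)⟩)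
      _ = ∑ i ∈ Q, |a i - a' i (n Y i)| + ∑ i ∈ P Y \ Q, |a i - a' i (n Y i)| := by
          rw [← sum_sdiff hQY, add_comm]
      _ ≤ ε / 3 + ∑ i ∈ P Y \ Q, c i := by
          refine add_le_add hY3.le (sum_le_sum fun i hi => ?_)
          have hiP : i ∈ P Y := (mem_sdiff.mp hi).1
          rw [abs_of_nonneg (by linarith [ha'le i (n Y i)])]
          linarith [hlow i (n Y i) (hn2 Y i hiP), ha1 i]
      _ ≤ ε / 3 + ε / 3 := by
          refine add_le_add le_rfl ((sum_sdiff_le_tsum_subtype hc hc0 (P Y) Q).trans hQ.le)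
  have := (abs_le.mp hdiff).2
  linarith

/-! ## §5. The sandwich: `F(X) → c·∏' aᵢ` -/

/-- **The analytic skeleton of the square-free sieve** (Bhargava–Shankar 2015, proof of Thm 2.21).
Let `f(X)` (= `N_φ(V_ℤ^{(i)};X)/X^{5/6}`) be sandwiched, for every level `Y`, as
`f_Y⁻(X) − e_Y(X) ≤ f(X) ≤ f_Y⁺(X)` for all large `X`, where `f_Y⁺ → c·U_Y` and `f_Y⁻ → c·L_Y`
(`X → ∞`; Thm 2.12 for the finitely many congruence weights of level `Y`), `limsup_X e_Y ≤ u_Y`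
(the uniformity estimate Thm 2.13 for `∪_{p>Y} W_p`), `u_Y → 0`, and
`limsup_Y U_Y ≤ A ≤ liminf_Y L_Y` (`eventually_prod_le_tprod_add`, `eventually_tprod_sub_le_prod`,
with `A = ∏_p ∫ φ_p`). Then `f(X) → c·A`. [cite: BhargavaShankarAnnals2015, §2.7, proof of Thm 2.21 (published numbering)] -/
theorem tendsto_of_sandwich_levels {f : ℝ → ℝ} {fup flow e : ℕ → ℝ → ℝ} {U L u : ℕ → ℝ} {c A : ℝ}
    (hc : 0 ≤ c)
    (hle : ∀ Y, ∀ᶠ X in atTop, flow Y X - e Y X ≤ f X ∧ f X ≤ fup Y X)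
    (hup : ∀ Y, Tendsto (fup Y) atTop (𝓝 (c * U Y)))
    (hlow : ∀ Y, Tendsto (flow Y) atTop (𝓝 (c * L Y)))
    (he : ∀ Y, ∀ ε : ℝ, 0 < ε → ∀ᶠ X in atTop, e Y X ≤ u Y + ε)
    (hu : ∀ ε : ℝ, 0 < ε → ∀ᶠ Y in atTop, u Y ≤ ε)
    (hU : ∀ ε : ℝ, 0 < ε → ∀ᶠ Y in atTop, U Y ≤ A + ε)
    (hL : ∀ ε : ℝ, 0 < ε → ∀ᶠ Y in atTop, A - ε ≤ L Y) :
    Tendsto f atTop (𝓝 (c * A)) := by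
  rw [Metric.tendsto_nhds]
  intro ε hε
  set δ : ℝ := ε / (c + 4) with hδ
  have hc4 : 0 < c + 4 := by linarith
  have hδpos : 0 < δ := div_pos hε hc4
  have hδε : (c + 3) * δ < ε := by
    rw [hδ, ← mul_div_assoc, div_lt_iff₀ hc4]
    nlinarith
  -- choose one good level `Y`
  obtain ⟨Y, hUY, hLY, huY⟩ := ((hU δ hδpos).and ((hL δ hδpos).and (hu δ hδpos))).exists
  have h1 : ∀ᶠ X in atTop, fup Y X < c * U Y + δ := (hup Y).eventually (Iio_mem_nhds (by linarith))
  have h2 : ∀ᶠ X in atTop, c * L Y - δ < flow Y X := (hlow Y).eventually (Ioi_mem_nhds (by linarith))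
  filter_upwards [hle Y, h1, h2, he Y δ hδpos] with X hX hX1 hX2 hX3
  rw [Real.dist_eq, abs_lt]
  have hcU : c * U Y ≤ c * (A + δ) := mul_le_mul_of_nonneg_left hUY hc
  have hcL : c * (A - δ) ≤ c * L Y := mul_le_mul_of_nonneg_left hLY hc
  constructor
  · nlinarith [hX.1, hX2, hX3, hcL]
  · nlinarith [hX.2, hX1, hcU]

end BhargavaShankar

end Literature.NumberTheory.EllipticCurves

end
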